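import Literature.Probability.RandomPlanarGeometry.SLEDerivRatioItoProcess
import HarnessLib

/-!
# Rohde–Schramm's observable with the elementary supersolution is a supermartingale in expectation

Topic `Probability/RandomPlanarGeometry`; step S4b of the discharge of Rohde–Schramm's Lemma 6.3
(`κ < 8`; named fact `Literature.Probability.RandomPlanarGeometry.exists_tendsto_sleDerivRatio_of_lt_eight`).
For the observable `M = G(w) ψ^a` of `SLEDerivRatioItoProcess.lean` (`sleSuperObs`; `G = rsSuperG κ`,
`a = rsSuperExp κ`, everything stopped at the localizing time `ρₙ`) we prove:

* `ae_sleSuperObs_eq` — the **semimartingale decomposition** (product rule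
  `d(G(w) ψ^a) = G(w) d(ψ^a) + ψ^a dG(w)`): almost surely, for all `t`,
  `M_t = M_0 + ∫₀ᵗ D_s ds + K_t` with `D = sleSuperObsDrift` and `K = ∫ σ_w G'(w) ψ^a dB` a
  martingale;
* `sleSuperObsDrift_eq_of_le` / `sleSuperObsDrift_nonpos` — **the drift is
  `(ψ^a/Y²) · D_G(w) ≤ 0`** before `ρₙ` (`D_G = rsSuperDrift κ`, `rsSuperDrift_nonpos`, `κ < 8`)
  and `0` after: the generator computation of Rohde–Schramm's proof (p. 904: the drift term of
  Itô's formula for `(gₜ - ξₜ)`-functionals, here with `Ĝ` replaced by the supersolution);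
* `integral_sleSuperObs_le` — **`E[M_t] ≤ M_0 = G(re z/im z) ≤ 2`**, and since `G ≥ 1`,
  `integral_slePointRatioPow_le` — **`E[ψ_{t∧ρₙ}^a] ≤ 2`** for all `n`, `t` ("`Ĝ(ẑ) = M₀ =
  E[M_{t̄ₙ}] ≥ … E[Z^a]`-type bound, p. 905, in supermartingale form).

## References

* S. Rohde, O. Schramm, *Basic properties of SLE*, Ann. of Math. 161 (2005), proof of Lemma 6.3
  (pp. 904–905).
* D. Revuz, M. Yor, *Continuous Martingales and Brownian Motion* (1999), Ch. IV, Prop. (3.1),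
  Thm (3.3); Ch. II (supermartingales).
-/

noncomputable section

open Set Filter MeasureTheory Metric Complex
open _root_.Topology
open scoped NNReal ENNReal

namespace Literature.Probability.RandomPlanarGeometry

open Loewner Literature.Probability.Process Literature.Analysis.FunctionSpaces

variable {κ : ℝ≥0} {z : ℂ} {n : ℕ}

/-! ### The finite-variation factor `ψ^a` and the product rule -/

/-- `a = rsSuperExp κ ≥ 0` for `κ ≤ 8`. [folklore] -/
theorem rsSuperExp_coe_nonneg (hκ8 : κ ≤ 8) : 0 ≤ rsSuperExp (κ : ℝ) :=
  rsSuperExp_nonneg κ.coe_nonneg (by exact_mod_cast hκ8)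

/-- `ψ^a` is bounded: `|ψ^a| ≤ exp(a · 4((n+2)/im z)²(n+1))` (`a ≥ 0`). [folklore] -/
theorem abs_slePointRatioPow_le (hκ8 : κ ≤ 8) (hz : 0 < z.im) (t : ℝ≥0) (ω : ℝ≥0 → ℝ) :
    |slePointRatioPow κ z n (rsSuperExp κ) t ω| ≤
      Real.exp (rsSuperExp κ * (4 * ((n + 2) / z.im) ^ 2 * (n + 1))) := by
  obtain ⟨h1, h2⟩ := slePointRatioPow_mem hz (rsSuperExp_coe_nonneg hκ8) t ω (κ := κ) (n := n)
  rw [abs_of_pos (slePointRatioPow_pos _ _ _)]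
  exact h2

/-- The rate of `ψ^a` is locally integrable along every path. [folklore] -/
theorem integrableOn_slePointRatioPowRate (hz : 0 < z.im) (ω : ℝ≥0 → ℝ) (t : ℝ≥0) :
    IntegrableOn (fun s : ℝ ↦ slePointRatioPowRate κ z n s.toNNReal ω) (Icc 0 t) := by
  have h : (fun s : ℝ ↦ slePointRatioPowRate κ z n s.toNNReal ω) = fun s ↦
      trunc (slePointLocTime κ z n) (fun s ω ↦ rsSuperExp κ *
        (4 * slePointImStop κ z n s ω ^ 2 / slePointNormSqStop κ z n s ω ^ 2) *
          slePointRatioPow κ z n (rsSuperExp κ) s ω) s.toNNReal ω := by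
    funext s
    have := congrFun (congrFun (ratioPowRate_eq_trunc (κ := κ) (z := z) (n := n) (rsSuperExp κ))
      s.toNNReal) ω
    simpa [slePointRatioPowRate] using this
  rw [h]
  refine integrableOn_trunc ?_
  have hc : Continuous fun s : ℝ≥0 ↦ rsSuperExp κ *
      (4 * slePointImStop κ z n s ω ^ 2 / slePointNormSqStop κ z n s ω ^ 2) *
        slePointRatioPow κ z n (rsSuperExp κ) s ω :=
    (continuous_const.mul (continuous_slePointRatioRate_untrunc hz ω)).mul
      (continuous_slePointRatioPow hz _ ω)
  exact (hc.comp continuous_real_toNNReal).continuousOn.integrableOn_compact isCompact_Icc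

/-- `ψ^a_t = ψ^a_0 + ∫₀ᵗ (rate of ψ^a) ds` (every `ω`, `t`; `ψ^a_0 = 1`). [folklore] -/
theorem slePointRatioPow_eq_zero_add (hz : 0 < z.im) (ω : ℝ≥0 → ℝ) (t : ℝ≥0) :
    slePointRatioPow κ z n (rsSuperExp κ) t ω = slePointRatioPow κ z n (rsSuperExp κ) 0 ω +
      ∫ s in (0 : ℝ)..t, slePointRatioPowRate κ z n s.toNNReal ω := by
  have h0 : slePointRatioPow κ z n (rsSuperExp κ) 0 ω = 1 := by
    simp [slePointRatioPow, timeIntegral_apply_zero]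
  rw [h0, slePointRatioPow_eq_one_add hz]
  rfl

/-- The diffusion coefficient `σ_w G'(w) ψ^a` of the observable is progressive. [folklore] -/
theorem isStronglyProgressive_sleSuperObsDiffusion (κ : ℝ≥0) (hz : 0 < z.im) (n : ℕ) :
    IsStronglyProgressive brownianFiltration (sleSuperObsDiffusion κ z n) :=
  (isStronglyProgressive_rsSuperGDiffusion κ hz n).mul (isStronglyProgressive_slePointRatioPow κ hz n _)

/-- **Semimartingale decomposition of the observable** (product rule
`d(G(w) ψ^a) = G(w) d(ψ^a) + ψ^a dG(w)`): almost surely, for all `t`,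
`M_t = M_0 + ∫₀ᵗ D_s ds + K_t`, where `D = sleSuperObsDrift κ z n` and `K = ∫ σ_w G'(w) ψ^a dB` is a
martingale. [cite: RohdeSchramm2005, Lemma 6.3 (proof)] -/
theorem ae_sleSuperObs_eq (hκ8 : κ ≤ 8) (hz : 0 < z.im) :
    ∃ K : ℝ≥0 → (ℝ≥0 → ℝ) → ℝ,
      IsItoIntegral (sleSuperObsDiffusion κ z n) brownian K brownianFiltration preWienerMeasure ∧
      Martingale K brownianFiltration preWienerMeasure ∧
      ∀ᵐ ω ∂preWienerMeasure, ∀ t : ℝ≥0, sleSuperObs κ z n t ω =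
        sleSuperObs κ z n 0 ω + timeIntegral (sleSuperObsDrift κ z n) t ω + K t ω := by
  obtain ⟨C, hC0, hC⟩ := exists_bound_deriv_rsSuperG_slePointSlope hz (κ := κ) (n := n)
  obtain ⟨KN, hKN, hKNM, hN, -⟩ := isItoProcess_rsSuperG_slePointSlope hz (κ := κ) (n := n)
  have hσN := isStronglyProgressive_rsSuperGDiffusion κ hz n
  have hNprog : IsStronglyProgressive brownianFiltration fun t ω ↦ rsSuperG κ (slePointSlope κ z n t ω) :=
    IsStronglyProgressive.continuous_comp (isStronglyProgressive_slePointSlope κ hz n)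
      (contDiff_rsSuperG (κ : ℝ) (n := 0)).continuous
  have hEprog := isStronglyProgressive_slePointRatioPow κ hz n (rsSuperExp κ)
  have hσNbd : ∀ t ω, |rsSuperGDiffusion κ z n t ω| ≤ Real.sqrt κ * ((n + 2) / z.im) * C := fun t ω ↦ by
    rw [rsSuperGDiffusion, abs_mul]
    exact mul_le_mul (abs_slePointSlopeDiffusion_le hz t ω) (hC t ω).1 (abs_nonneg _)
      (mul_nonneg (Real.sqrt_nonneg _) (div_nonneg (by positivity) hz.le))
  have hGbd : ∀ t ω, |rsSuperG κ (slePointSlope κ z n t ω)| ≤ 2 := fun t ω ↦ by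
    rw [abs_of_pos (rsSuperG_pos _ _)]
    exact rsSuperG_le_two (by linarith [κ.coe_nonneg]) (by exact_mod_cast hκ8) _
  -- Itô integrals of `σ_N · N` and `σ_N · ψ^a`
  obtain ⟨KX, hKX, hKXM, -⟩ := exists_isItoIntegral_of_abs_le (hσN.mul hNprog)
    (C := Real.sqrt κ * ((n + 2) / z.im) * C * 2) fun t ω ↦ by
      rw [abs_mul]
      exact mul_le_mul (hσNbd t ω) (hGbd t ω) (abs_nonneg _) (by positivity)
  obtain ⟨K, hK, hKM, -⟩ := exists_isItoIntegral_of_abs_le (hσN.mul hEprog)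
    (C := Real.sqrt κ * ((n + 2) / z.im) * C *
      Real.exp (rsSuperExp κ * (4 * ((n + 2) / z.im) ^ 2 * (n + 1)))) fun t ω ↦ by
      rw [abs_mul]
      exact mul_le_mul (hσNbd t ω) (abs_slePointRatioPow_le hκ8 hz t ω) (abs_nonneg _) (by positivity)
  have hNa : StronglyAdapted brownianFiltration fun t ω ↦ rsSuperG κ (slePointSlope κ z n t ω) :=
    fun t ↦ (contDiff_rsSuperG (κ : ℝ) (n := 0)).continuous.comp_stronglyMeasurable
      (stronglyAdapted_slePointSlope κ hz n t)
  have hNc : ∀ ω, Continuous fun t ↦ rsSuperG κ (slePointSlope κ z n t ω) := fun ω ↦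
    (contDiff_rsSuperG (κ : ℝ) (n := 0)).continuous.comp (continuous_slePointSlope hz ω)
  have hmul := ae_mul_eq_of_isItoProcess hNa hNc hσN hN (stronglyAdapted_slePointRatioPow κ hz n _)
    (continuous_slePointRatioPow hz _) (ae_of_all _ (slePointRatioPow_eq_zero_add hz))
    (ae_of_all _ fun ω t ↦ integrableOn_slePointRatioPowRate hz ω t) hKX hKXM hK hKM
  refine ⟨K, hK, hKM, ?_⟩
  filter_upwards [hmul] with ω hω t
  rw [sleSuperObs, sleSuperObs, hω t]
  rfl

/-! ### The drift is non-positive -/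

/-- The generator algebra behind `sleSuperObsDrift_eq_of_le`: with `Q = X² + Y²`, `w = X/Y`,
`k² = κ`, `G₀(a·4Y²/Q²·E) + E((X·2/(YQ) + Y⁻¹·2X/Q)G₁ + ½(-k Y⁻¹)²G₂)
= (E/Y²)(4aG₀/(1+w²)² + 4wG₁/(1+w²) + (κ/2)G₂)`. [folklore] -/
theorem superObs_drift_algebra {X Y E a k κ' G₀ G₁ G₂ : ℝ} (hY : Y ≠ 0) (hk : k ^ 2 = κ') :
    G₀ * (a * (4 * Y ^ 2 / (X ^ 2 + Y ^ 2) ^ 2) * E) +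
        E * ((X * (2 / (Y * (X ^ 2 + Y ^ 2))) + Y⁻¹ * (2 * X / (X ^ 2 + Y ^ 2))) * G₁ +
          2⁻¹ * (-k * Y⁻¹) ^ 2 * G₂) =
      E / Y ^ 2 * (4 * a * G₀ / (1 + (X / Y) ^ 2) ^ 2 + 4 * (X / Y) * G₁ / (1 + (X / Y) ^ 2) +
        κ' / 2 * G₂) := by
  have hQ : X ^ 2 + Y ^ 2 ≠ 0 := by positivity
  rw [← hk]
  have h1w : 1 + (X / Y) ^ 2 = (X ^ 2 + Y ^ 2) / Y ^ 2 := by field_simp; ring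
  rw [h1w]
  field_simp
  ring

/-- **The drift before `ρₙ`**: for `s ≤ ρₙ`, `D_s = (ψ^a_s / Y_s²) · D_G(w_s)` with
`D_G = rsSuperDrift κ` — the generator computation: with `Q = Y²(1 + w²)`, `X = wY`,
`G · a(4Y²/Q²) + (4X/(YQ)) G' + ½ (κ/Y²) G'' = (1/Y²) (4aG/(1+w²)² + 4wG'/(1+w²) + (κ/2)G'')`.
[cite: RohdeSchramm2005, Lemma 6.3 (proof)] -/
theorem sleSuperObsDrift_eq_of_le (hz : 0 < z.im) {s : ℝ≥0} {ω : ℝ≥0 → ℝ}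
    (hs : (s : WithTop ℝ≥0) ≤ slePointLocTime κ z n ω) :
    sleSuperObsDrift κ z n s ω = slePointRatioPow κ z n (rsSuperExp κ) s ω /
      slePointImStop κ z n s ω ^ 2 * rsSuperDrift κ (slePointSlope κ z n s ω) := by
  have hY := slePointImStop_pos hz s ω (κ := κ) (n := n)
  set X := slePointReStop κ z n s ω with hX
  set Y := slePointImStop κ z n s ω with hYdef
  set E := slePointRatioPow κ z n (rsSuperExp κ) s ω with hE
  have hQeq : slePointNormSqStop κ z n s ω = X ^ 2 + Y ^ 2 := rfl
  have hw : slePointSlope κ z n s ω = X / Y := by rw [slePointSlope, slePointInvIm, div_eq_mul_inv]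
  rw [hw]
  simp only [sleSuperObsDrift, slePointRatioPowRate, rsSuperGDrift, slePointSlopeDrift,
    slePointSlopeDiffusion, slePointInvIm, slePointRatioRate, slePointInvImRate, slePointReDrift,
    slePointDiffusion, trunc_of_le hs, rsSuperDrift, hw, hQeq, ← hX, ← hYdef, ← hE]
  exact superObs_drift_algebra hY.ne' (Real.sq_sqrt κ.coe_nonneg)

/-- **The drift is non-positive** (`κ < 8`): before `ρₙ` by `sleSuperObsDrift_eq_of_le` and
`rsSuperDrift_nonpos`; after `ρₙ` all truncated coefficients vanish and the drift is `0`.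
[cite: RohdeSchramm2005, Lemma 6.3 (proof)] -/
theorem sleSuperObsDrift_nonpos (hκ8 : κ < 8) (hz : 0 < z.im) (s : ℝ≥0) (ω : ℝ≥0 → ℝ) :
    sleSuperObsDrift κ z n s ω ≤ 0 := by
  by_cases hs : (s : WithTop ℝ≥0) ≤ slePointLocTime κ z n ω
  · rw [sleSuperObsDrift_eq_of_le hz hs]
    exact mul_nonpos_of_nonneg_of_nonpos
      (div_nonneg (slePointRatioPow_pos _ _ _).le (sq_nonneg _))
      (rsSuperDrift_nonpos κ.coe_nonneg (by exact_mod_cast hκ8) _)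
  · simp only [sleSuperObsDrift, slePointRatioPowRate, rsSuperGDrift, slePointSlopeDrift,
      slePointSlopeDiffusion, slePointRatioRate, slePointInvImRate, slePointReDrift,
      slePointDiffusion, trunc_of_not_le hs]
    simp

/-- The time integral of the drift is non-positive. [folklore] -/
theorem timeIntegral_sleSuperObsDrift_nonpos (hκ8 : κ < 8) (hz : 0 < z.im) (t : ℝ≥0) (ω : ℝ≥0 → ℝ) :
    timeIntegral (sleSuperObsDrift κ z n) t ω ≤ 0 := by
  rw [timeIntegral, intervalIntegral.integral_of_le t.coe_nonneg]
  exact setIntegral_nonpos measurableSet_Ioc fun s _ ↦ sleSuperObsDrift_nonpos hκ8 hz _ _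

/-! ### Expectations -/

/-- The observable is bounded: `0 ≤ M ≤ 2 exp(a · 4((n+2)/im z)²(n+1))`. [folklore] -/
theorem sleSuperObs_mem (hκ8 : κ ≤ 8) (hz : 0 < z.im) (t : ℝ≥0) (ω : ℝ≥0 → ℝ) :
    sleSuperObs κ z n t ω ∈ Icc (0 : ℝ) (2 * Real.exp (rsSuperExp κ * (4 * ((n + 2) / z.im) ^ 2 * (n + 1)))) := by
  obtain ⟨h1, h2⟩ := slePointRatioPow_mem hz (rsSuperExp_coe_nonneg hκ8) t ω (κ := κ) (n := n)
  have hG1 := one_lt_rsSuperG (κ : ℝ) (slePointSlope κ z n t ω)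
  have hG2 := rsSuperG_le_two (by linarith [κ.coe_nonneg]) (by exact_mod_cast hκ8) (slePointSlope κ z n t ω)
    (κ := (κ : ℝ))
  refine ⟨mul_nonneg (zero_le_one.trans hG1.le) (zero_le_one.trans h1), ?_⟩
  exact mul_le_mul hG2 h2 (zero_le_one.trans h1) zero_le_two

/-- `ψ^a ≤ M` (`G ≥ 1`). [folklore] -/
theorem slePointRatioPow_le_sleSuperObs (t : ℝ≥0) (ω : ℝ≥0 → ℝ) :
    slePointRatioPow κ z n (rsSuperExp κ) t ω ≤ sleSuperObs κ z n t ω := by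
  rw [sleSuperObs]
  exact le_mul_of_one_le_left (slePointRatioPow_pos _ _ _).le (one_lt_rsSuperG _ _).le

/-- `M_0 = G(re z / im z) ≤ 2`. [folklore] -/
theorem sleSuperObs_zero (hz : 0 < z.im) (ω : ℝ≥0 → ℝ) :
    sleSuperObs κ z n 0 ω = rsSuperG κ (z.re / z.im) := by
  rw [sleSuperObs, slePointSlope_zero hz]
  simp [slePointRatioPow, timeIntegral_apply_zero]

/-- The observable is strongly measurable at each time. [folklore] -/
theorem stronglyMeasurable_sleSuperObs (κ : ℝ≥0) (hz : 0 < z.im) (n : ℕ) (t : ℝ≥0) :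
    StronglyMeasurable (sleSuperObs κ z n t) := by
  have h1 : StronglyMeasurable fun ω ↦ rsSuperG κ (slePointSlope κ z n t ω) :=
    ((contDiff_rsSuperG (κ : ℝ) (n := 0)).continuous.comp_stronglyMeasurable
      (stronglyAdapted_slePointSlope κ hz n t)).mono (brownianFiltration.le t)
  have h2 : StronglyMeasurable (slePointRatioPow κ z n (rsSuperExp κ) t) :=
    (stronglyAdapted_slePointRatioPow κ hz n _ t).mono (brownianFiltration.le t)
  exact h1.mul h2

/-- The observable is integrable at each time (bounded and measurable). [folklore] -/
theorem integrable_sleSuperObs (hκ8 : κ ≤ 8) (hz : 0 < z.im) (t : ℝ≥0) :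
    Integrable (sleSuperObs κ z n t) preWienerMeasure := by
  haveI := isProbabilityMeasure_preWienerMeasure'
  refine Integrable.of_bound (stronglyMeasurable_sleSuperObs κ hz n t).aestronglyMeasurable
    (2 * Real.exp (rsSuperExp κ * (4 * ((n + 2) / z.im) ^ 2 * (n + 1)))) (ae_of_all _ fun ω ↦ ?_)
  obtain ⟨h0, h1⟩ := sleSuperObs_mem hκ8 hz t ω (κ := κ) (n := n)
  rw [Real.norm_eq_abs, abs_of_nonneg h0]
  exact h1

/-- **`E[M_t] ≤ M_0 = G(re z/im z)`**: the observable is a supermartingale in expectation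
(`M_t ≤ M_0 + K_t` a.s. with `K` a martingale vanishing at `0`). [cite: RohdeSchramm2005, Lemma 6.3 (proof)] -/
theorem integral_sleSuperObs_le (hκ8 : κ < 8) (hz : 0 < z.im) (t : ℝ≥0) :
    ∫ ω, sleSuperObs κ z n t ω ∂preWienerMeasure ≤ rsSuperG κ (z.re / z.im) := by
  haveI := isProbabilityMeasure_preWienerMeasure'
  obtain ⟨K, hK, hKM, hae⟩ := ae_sleSuperObs_eq hκ8.le hz (κ := κ) (n := n)
  have hKint : Integrable (K t) preWienerMeasure := hKM.integrable t
  have hK0 : ∫ ω, K t ω ∂preWienerMeasure = 0 := by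
    have h := hKM.setIntegral_eq (bot_le : (0 : ℝ≥0) ≤ t) (MeasurableSet.univ : MeasurableSet[brownianFiltration 0] univ)
    rw [Measure.restrict_univ] at h
    rw [← h]
    simp [hK.apply_zero]
  have hle : ∀ᵐ ω ∂preWienerMeasure, sleSuperObs κ z n t ω ≤ rsSuperG κ (z.re / z.im) + K t ω := by
    filter_upwards [hae] with ω hω
    rw [hω t, sleSuperObs_zero hz]
    linarith [timeIntegral_sleSuperObsDrift_nonpos hκ8 hz t ω (n := n)]
  calc ∫ ω, sleSuperObs κ z n t ω ∂preWienerMeasure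
      ≤ ∫ ω, (rsSuperG κ (z.re / z.im) + K t ω) ∂preWienerMeasure :=
        integral_mono_ae (integrable_sleSuperObs hκ8.le hz t) ((integrable_const _).add hKint) hle
    _ = rsSuperG κ (z.re / z.im) := by
        rw [integral_add (integrable_const _) hKint, integral_const, hK0]
        simp

/-- **`E[ψ_{t∧ρₙ}^a] ≤ 2`** for every `n` and `t` (`a = rsSuperExp κ`, `0 ≤ κ < 8`, `z ∈ ℍ`): the
moment bound behind the finiteness of `Z(z)` in Rohde–Schramm's Lemma 6.3 (`κ < 8`), here from the
supermartingale `G(w) ψ^a ≥ ψ^a` with `G(w₀) ≤ 2`. [cite: RohdeSchramm2005, Lemma 6.3] -/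
theorem integral_slePointRatioPow_le (hκ8 : κ < 8) (hz : 0 < z.im) (n : ℕ) (t : ℝ≥0) :
    ∫ ω, slePointRatioPow κ z n (rsSuperExp κ) t ω ∂preWienerMeasure ≤ 2 := by
  haveI := isProbabilityMeasure_preWienerMeasure'
  have hEint : Integrable (slePointRatioPow κ z n (rsSuperExp κ) t) preWienerMeasure := by
    refine Integrable.of_bound ((stronglyAdapted_slePointRatioPow κ hz n _ t).mono
      (brownianFiltration.le t)).aestronglyMeasurable
      (Real.exp (rsSuperExp κ * (4 * ((n + 2) / z.im) ^ 2 * (n + 1)))) (ae_of_all _ fun ω ↦ ?_)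
    rw [Real.norm_eq_abs]
    exact abs_slePointRatioPow_le hκ8.le hz t ω
  calc ∫ ω, slePointRatioPow κ z n (rsSuperExp κ) t ω ∂preWienerMeasure
      ≤ ∫ ω, sleSuperObs κ z n t ω ∂preWienerMeasure :=
        integral_mono hEint (integrable_sleSuperObs hκ8.le hz t) fun ω ↦ slePointRatioPow_le_sleSuperObs t ω
    _ ≤ rsSuperG κ (z.re / z.im) := integral_sleSuperObs_le hκ8 hz t
    _ ≤ 2 := rsSuperG_le_two (by linarith [κ.coe_nonneg]) (by exact_mod_cast hκ8.le) _

end Literature.Probability.RandomPlanarGeometry
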